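import Mathlib
import Summits.MatrixMultiplication.MatrixMultiplication.Theses.FourierTwoFamiliesModP
import Summits.MatrixMultiplication.MatrixMultiplication.Theorems.FourierTwoFamiliesModPPrimeTwoFamiliesCapacityEquivalences

/-!
# Line `paley-pattern-capacity` — an ALTERNATIVE skeleton for crux `PrimeTwoFamilies`
# (stmt-MatrixMultiplication-14308), strategist s2 (2026-08-17).  Does NOT touch the lead's line `Sketch`.

THE PATTERN AXIS.  In the capacity form of the crux (CKSU 2005 §7 "charts"; the lead's `CapacityGadgets`,
landed `CapacityLift.capacityGadgets_iff_primeTwoFamilies`) a level gadget of direct pairs `(P σ, Q σ)` in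
`ℤ/m` carries a STRONG-SEPARATION DIGRAPH `D` (σ → τ iff `Q τ − P σ` avoids every diagonal set `Q c − P c`),
and zero-error codes over the gadget are exactly Sperner-capacity codes of `D` (Gargano–Körner–Vaccaro).
Besides the co-volume scale there is therefore a second parameter: the PATTERN demanded of the gadget.
COMPLETE / TRANSITIVE patterns on `≈ √m` letters are the crux itself (an SDPP family is completely separated;
ladders ↔ crux, `primeTwoFamilies_iff_cyclicLadder`).  For an explicit NON-transitive tournament the two
requirements come apart, and for the PALEY TOURNAMENT `P_q` (`q ≡ 3 mod 4` prime; σ → τ iff `τ − σ` is a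
non-zero square) they are:

* `stub_paleyGadgets` — for every `ε > 0`, arbitrarily large `m`, a prime `q ≡ 3 (4)` with `q ≥ m^{1/2-ε}`
  and `q` direct pairs in `ℤ/m` of co-volume `≥ m^{1-ε}` whose separation digraph CONTAINS `P_q`
  (σ → τ strongly separated whenever `τ − σ` is a square).  A CONSEQUENCE of the crux (an honest apex
  family of `n ≈ p^{1/2-δ/4}` blocks in `ℤ/p` is completely separated, hence contains every pattern on
  `≤ n` letters; primes `≡ 3 (4)` in `[m^{1/2-ε}, n]` by Dirichlet), and much weaker in known consequence:
  with the KNOWN capacity `Σ(P_q) ≥ ½ log q` (self-converse words `(σ, νσ)`, Alon 1998) it yields designs at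
  `(θ, γ) = (1/4, 1)` only, i.e. `ω ≤ 2.5` through the route's `closes` argument — above the translate wall
  `θ + γ = 1`, defect `0.25` at `γ = 1` versus the cyclic record ratio `0.2729`, but not the apex.
* `stub_paleyCapacity` — the Sperner capacity of the Paley tournaments is FULL IN EXPONENT:
  `Σ(P_q) ≥ (1-ε) log q` for all large `q ≡ 3 (4)`, i.e. for some word length `L ≥ 1` a set `W` of
  `≥ q^{(1-ε)L}` words in `(Fin L → 𝔽_q)` every ordered pair of which has a coordinate `t` with `w t − u t`
  a non-zero square.  OPEN in print: `½ log q ≤ Σ(P_q) ≤ log((q+1)/2)` (lower: self-converse trick; upper: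
  Alon's out-degree bound = Blokhuis' polynomial bound, tight for `q = 3`: `Σ(C⃗₃) = 1`).  Pure zero-error
  information theory — no additive combinatorics.

COMPOSITION (kernel-checked below, no sorry of its own): the code of stub 2 over the gadget of stub 1 is a
zero-error code of size `≥ q^{(1-ε/2)L} ≥ (m^L)^{1/2-ε}`, so `CapacityGadgets` holds and the landed
`capacityGadgets_iff_primeTwoFamilies` gives the crux BY NAME.

HONEST STATUS (strategist's own falsifiers, folder calc/): exact max Paley–Sperner codes `ω(Γ_{7,2}) = 7`,
`ω(Γ_{11,2}) = 11` (length 2 is trivially `≤ q`), `ω(Γ_{7,3}) = 13 < 7^{3/2}`, `ω(Γ_{7,4}) ≥ 49 = 7²` with the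
product code MAXIMAL and 1230 local-search restarts finding nothing larger: NO superadditivity at `q = 7`,
`L ≤ 4` — the natural conjecture `Σ(P_q) = (½ + o(1)) log q` stands, so stub 2 is PROBABLY FALSE and its
refutation (any bound `Σ(P_q) ≤ (1-c) log q`, which would improve Alon 1998 for the first natural family)
is the informative ending: it closes the "imperfect self-converse pattern" hatch of the capacity route for
Paley patterns.  Stub 1's cheapest falsifier is a census cell the lead's SAT machinery can run today
(tournament-pattern gadgets; calc/gadget3.py: cyclic-triangle 3-gadgets exist in `ℤ/m`, min co-volume
1,2,2,3,3,4 for m = 5..10 against ladders' 2,2,3,·,4,4).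
-/

-- single-conjunct summit: the mandated namespace repeats `MatrixMultiplication`.
set_option linter.dupNamespace false

namespace Summit.MatrixMultiplication.MatrixMultiplication.Cruxes.PrimeTwoFamilies.PaleyPatternCapacity

open Finset
open Summit.MatrixMultiplication.MatrixMultiplication.Theses
open Summit.MatrixMultiplication.MatrixMultiplication.Theorems

/-! ## Registered stubs (2) -/

/-- STUB 1 (OPEN; a consequence of the crux, strictly weaker in known consequence): **PALEY-PATTERN
GADGETS** — for every `ε > 0` and every `m₀` there are `m ≥ m₀`, a prime `q ≡ 3 (mod 4)` with
`m^{1/2-ε} ≤ q`, and `q` DIRECT pairs `(P σ, Q σ)_{σ : Fin q}` in `ZMod m` of co-volume `≥ m^{1-ε}` such that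
`σ` is strongly separated towards `τ` (the cross set `Q τ − P σ` avoids every diagonal set `Q c − P c`)
whenever `τ − σ` is a square in `ZMod q` (`σ ≠ τ`).  Since `−1` is a non-square, every pair of distinct
letters is separated in at least one direction. -/
theorem stub_paleyGadgets :
    ∀ ε : ℝ, 0 < ε → ∀ m₀ : ℕ, ∃ m ≥ m₀, ∃ q : ℕ, q.Prime ∧ q % 4 = 3 ∧
      (m : ℝ) ^ (1 / 2 - ε) ≤ (q : ℝ) ∧
      ∃ P Q : Fin q → Finset (ZMod m),
      (∀ c : Fin q, ∀ x ∈ P c, ∀ x' ∈ P c, ∀ y ∈ Q c, ∀ y' ∈ Q c,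
          (x - x') + (y - y') = 0 → x = x' ∧ y = y') ∧
      (∀ σ τ : Fin q, σ ≠ τ → IsSquare (((τ : ℕ) : ZMod q) - ((σ : ℕ) : ZMod q)) →
        ∀ p ∈ P σ, ∀ y ∈ Q τ, ∀ c : Fin q, ∀ p' ∈ P c, ∀ y' ∈ Q c, y - p ≠ y' - p') ∧
      ∀ c : Fin q, (m : ℝ) ^ (1 - ε) ≤ (((P c).card * (Q c).card : ℕ) : ℝ) := by
  sorry

/-- STUB 2 (OPEN both ways in print; probably false — see the header): **PALEY SPERNER CAPACITY, FULL IN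
EXPONENT** — for every `ε > 0` and all large primes `q ≡ 3 (mod 4)` there are a word length `L ≥ 1` and a
set `W` of words `Fin L → Fin q` with `|W| ≥ q^{(1-ε)L}` in which every ordered pair of distinct words
`(u, w)` has a coordinate `t` with `u t ≠ w t` and `w t − u t` a square in `ZMod q`. -/
theorem stub_paleyCapacity :
    ∀ ε : ℝ, 0 < ε → ∃ q₀ : ℕ, ∀ q : ℕ, q₀ ≤ q → q.Prime → q % 4 = 3 →
      ∃ L : ℕ, 1 ≤ L ∧ ∃ W : Finset (Fin L → Fin q),
        (q : ℝ) ^ ((1 - ε) * L) ≤ (W.card : ℝ) ∧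
        ∀ u ∈ W, ∀ w ∈ W, u ≠ w →
          ∃ t : Fin L, u t ≠ w t ∧ IsSquare (((w t : ℕ) : ZMod q) - ((u t : ℕ) : ZMod q)) := by
  sorry

/-! ## Composition (no sorry of its own) -/

set_option linter.defProp false in
/-- **Paley-pattern gadgets + full Paley capacity ⟹ the crux** (a `def` on purpose: the skeleton audit takes
THE theorem concluding the crux to be the unique `theorem` with that conclusion, `PrimeTwoFamilies_of` below;
the same term is landed as a `theorem` in the Theorems/ helper file).  The Sperner code of stub 2 over the
gadget of stub 1 is a zero-error code (`u t → w t` in `P_q` gives strong separation of letter `u t` towards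
`w t`), of size `q^{(1-ε/2)L} ≥ (m^{1/2-ε/2})^{(1-ε/2)L} ≥ (m^L)^{1/2-ε}`; the landed equivalence
`CapacityLift.capacityGadgets_iff_primeTwoFamilies` (p99109) turns the capacity gadgets into the crux. -/
def PrimeTwoFamilies_of_paley
    (hP : ∀ ε : ℝ, 0 < ε → ∀ m₀ : ℕ, ∃ m ≥ m₀, ∃ q : ℕ, q.Prime ∧ q % 4 = 3 ∧
      (m : ℝ) ^ (1 / 2 - ε) ≤ (q : ℝ) ∧
      ∃ P Q : Fin q → Finset (ZMod m),
      (∀ c : Fin q, ∀ x ∈ P c, ∀ x' ∈ P c, ∀ y ∈ Q c, ∀ y' ∈ Q c,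
          (x - x') + (y - y') = 0 → x = x' ∧ y = y') ∧
      (∀ σ τ : Fin q, σ ≠ τ → IsSquare (((τ : ℕ) : ZMod q) - ((σ : ℕ) : ZMod q)) →
        ∀ p ∈ P σ, ∀ y ∈ Q τ, ∀ c : Fin q, ∀ p' ∈ P c, ∀ y' ∈ Q c, y - p ≠ y' - p') ∧
      ∀ c : Fin q, (m : ℝ) ^ (1 - ε) ≤ (((P c).card * (Q c).card : ℕ) : ℝ))
    (hQ : ∀ ε : ℝ, 0 < ε → ∃ q₀ : ℕ, ∀ q : ℕ, q₀ ≤ q → q.Prime → q % 4 = 3 →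
      ∃ L : ℕ, 1 ≤ L ∧ ∃ W : Finset (Fin L → Fin q),
        (q : ℝ) ^ ((1 - ε) * L) ≤ (W.card : ℝ) ∧
        ∀ u ∈ W, ∀ w ∈ W, u ≠ w →
          ∃ t : Fin L, u t ≠ w t ∧ IsSquare (((w t : ℕ) : ZMod q) - ((u t : ℕ) : ZMod q))) :
    FourierTwoFamiliesModP.PrimeTwoFamilies := by
  refine PrimeTwoFamilies.CapacityLift.capacityGadgets_iff_primeTwoFamilies.1 ?_
  intro ε hε m₀
  -- work with ε' = min ε (1/4)
  set ε' : ℝ := min ε (1 / 4) with hε'def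
  have hε'pos : 0 < ε' := lt_min hε (by norm_num)
  have hε'le : ε' ≤ ε := min_le_left _ _
  have hε'4 : ε' ≤ 1 / 4 := min_le_right _ _
  -- capacity threshold for ε'/2
  obtain ⟨q₀, hq₀⟩ := hQ (ε' / 2) (by positivity)
  -- a gadget level beyond m₀, 2 and q₀^4, for ε'/2
  obtain ⟨m, hm, q, hq, hq3, hmq, P, Q, hD, hSep, hcov⟩ :=
    hP (ε' / 2) (by positivity) (max m₀ (max 2 (q₀ ^ 4)))
  have hm₀ : m₀ ≤ m := (le_max_left _ _).trans hm
  have hm2 : 2 ≤ m := ((le_max_left _ _).trans (le_max_right _ _)).trans hm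
  have hmq₀ : q₀ ^ 4 ≤ m := ((le_max_right _ _).trans (le_max_right _ _)).trans hm
  have hm1 : (1 : ℝ) ≤ m := by exact_mod_cast (show 1 ≤ m by omega)
  have hm0 : (0 : ℝ) ≤ m := by positivity
  -- the Paley prime is beyond the capacity threshold
  have hqq₀ : q₀ ≤ q := by
    have h1 : ((q₀ : ℝ) ^ (4 : ℕ)) ^ ((4 : ℕ)⁻¹ : ℝ) = (q₀ : ℝ) :=
      Real.pow_rpow_inv_natCast (Nat.cast_nonneg _) (by norm_num)
    have h2 : ((q₀ : ℝ) ^ (4 : ℕ)) ^ ((4 : ℕ)⁻¹ : ℝ) ≤ (m : ℝ) ^ ((4 : ℕ)⁻¹ : ℝ) :=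
      Real.rpow_le_rpow (by positivity) (by exact_mod_cast hmq₀) (by positivity)
    have h3 : (m : ℝ) ^ ((4 : ℕ)⁻¹ : ℝ) ≤ (m : ℝ) ^ (1 / 2 - ε' / 2) := by
      apply Real.rpow_le_rpow_of_exponent_le hm1
      push_cast
      linarith
    have h4 : (q₀ : ℝ) ≤ q := by linarith
    exact_mod_cast h4
  obtain ⟨L, hL, W, hWcard, hCode⟩ := hq₀ q hqq₀ hq hq3
  refine ⟨m, hm₀, q, L, P, Q, W, hD, ?_, hL, ?_, ?_⟩
  · -- the Paley code is a zero-error code over the gadget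
    intro i hi k hk hik
    obtain ⟨t, hne, hsq⟩ := hCode i hi k hk hik
    exact ⟨t, hSep (i t) (k t) hne hsq⟩
  · -- size bookkeeping: (m^L)^{1/2-ε} ≤ q^{(1-ε'/2)L} ≤ |W|
    have hL0 : (0 : ℝ) ≤ L := Nat.cast_nonneg _
    have hexp : (L : ℝ) * (1 / 2 - ε) ≤ (1 / 2 - ε' / 2) * ((1 - ε' / 2) * L) := by
      have key : (1 / 2 - ε) ≤ (1 / 2 - ε' / 2) * (1 - ε' / 2) := by nlinarith
      have := mul_le_mul_of_nonneg_left key hL0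
      linarith [this]
    calc ((m : ℝ) ^ (L : ℝ)) ^ (1 / 2 - ε)
        = (m : ℝ) ^ ((L : ℝ) * (1 / 2 - ε)) := (Real.rpow_mul hm0 _ _).symm
      _ ≤ (m : ℝ) ^ ((1 / 2 - ε' / 2) * ((1 - ε' / 2) * L)) :=
          Real.rpow_le_rpow_of_exponent_le hm1 hexp
      _ = ((m : ℝ) ^ (1 / 2 - ε' / 2)) ^ ((1 - ε' / 2) * L) := Real.rpow_mul hm0 _ _
      _ ≤ (q : ℝ) ^ ((1 - ε' / 2) * L) :=
          Real.rpow_le_rpow (by positivity) hmq (by nlinarith)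
      _ ≤ (W.card : ℝ) := hWcard
  · -- co-volumes: m^{1-ε} ≤ m^{1-ε'/2} ≤ |P c||Q c|
    intro c
    refine le_trans ?_ (hcov c)
    exact Real.rpow_le_rpow_of_exponent_le hm1 (by linarith)

/-- THE SKELETON THEOREM: the crux `PrimeTwoFamilies`, by name, from the two registered stubs (its only
sorries are theirs). -/
theorem PrimeTwoFamilies_of : FourierTwoFamiliesModP.PrimeTwoFamilies :=
  PrimeTwoFamilies_of_paley stub_paleyGadgets stub_paleyCapacity

end Summit.MatrixMultiplication.MatrixMultiplication.Cruxes.PrimeTwoFamilies.PaleyPatternCapacity
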